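import Literature.NumberTheory.Sieve.SmoothParitySingularMajorant
import HarnessLib

/-!
# The parity-class singular series: absolute convergence, tail, positivity, Euler product

Topic `Literature/NumberTheory/Sieve`; a PROVED file completing `SmoothParitySingular*`
([MontgomeryVaughanActa1975, §5–6], [Harper2016, §2.2, §5]). Standing hypotheses: `13/15 < α ≤ 1`, `σ = ±1`,
`d₁ ≥ 1` even, `d₂` odd (as for `2^N m + b = c` with `m, b` odd). Notation `T(k) = parityUnitTermR α d₁ d₂ k ≥ 0`,
`C(δ) = 3 (d₁d₂)^α exp(2420 (1 − α)/(3α − 13/5 − δ))`.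

* **(S1)** `summable_rpow_mul_norm_paritySingTerm`: `Σ_k k^δ ‖paritySingTerm k‖ ≤ C(δ)` for `δ < 3α − 13/5`
  (even/odd split against the unit terms, `SmoothParitySingularMajorant`);
  `summable_norm_paritySingTerm` (`δ = 0`) and the explicit tail `tsum_norm_paritySingTerm_add_le`:
  `Σ_{k ≥ R} ‖paritySingTerm k‖ ≤ C(δ) R^{−δ}` (`0 < δ < 3α − 13/5`, `R ≥ 1`);
* **(S4)** `paritySingSeries_eq`: `𝔖 = 2(1 − 2^{−α})³ · Σ_m T(2m+1)` (`= parityLocalTwo ·` odd part,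
  `paritySingSeries_eq_parityLocalTwo_mul`), so `𝔖` is REAL (`paritySingSeries_im`) with
  `2(1 − 2^{−α})³ ≤ 𝔖.re` (`le_paritySingSeries_re`, since `Σ_m T(2m+1) ≥ T(1) = 1`) and `‖𝔖‖ ≤ C(0)`
  (`norm_paritySingSeries_le`);
* **(S2, Euler product)** `hasProd_parityLocalOdd`: `∏_p E_p = Σ_m parityUnitTerm (2m+1)` (`HasProd` over
  `Nat.Primes`, `E_2 = 1`, `E_p = parityLocalOdd p` for odd `p`), each `E_p` real `≥ 1` (`parityLocalOdd_eq_ofReal`)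
  and `E_p ≤ 1 + 2 c_p p^{−(3α−1)}` for `p ∤ d₁d₂` (`tsum_parityUnitTermR_prime_pow_le`).

## References

* H. L. Montgomery, R. C. Vaughan, *The exceptional set in Goldbach's problem*, Acta Arith. 27 (1975), §5–6
  (singular series of a ternary problem with congruence conditions; local factors) [MontgomeryVaughanActa1975].
* A. J. Harper, Compositio Math. 152 (2016), §2.2, §5 (the smooth local factors `G_α`, `H_α`) [Harper2016].
* H. L. Montgomery, R. C. Vaughan, *Multiplicative Number Theory I* (2007), Thm 4.1 (Ramanujan sums), §1.3
  (Euler products) [MontgomeryVaughan2007].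
-/

noncomputable section

open Finset Real Complex
open scoped ArithmeticFunction.Moebius FourierTransform

namespace Literature.NumberTheory.Sieve

namespace SmoothArcs

/-! ### Absolute convergence and tail of the singular series (S1) -/

/-- **(S1) Weighted absolute convergence of the singular series.** For `13/15 < α ≤ 1`, `δ < 3α − 13/5`,
`σ = ±1`, `d₁ ≥ 1` even, `d₂` odd: `k ↦ k^δ ‖paritySingTerm k‖` is summable, with sum
`≤ 3 (d₁d₂)^α exp(2420(1−α)/(3α − 13/5 − δ))` (even/odd split against the unit terms). [cite: MontgomeryVaughanActa1975, §6] -/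
theorem summable_rpow_mul_norm_paritySingTerm {α : ℝ} (hα : 13 / 15 < α) (hα1 : α ≤ 1) {δ : ℝ}
    (hδ : δ < 3 * α - 13 / 5) {σ : ℤ} (hσ : σ = 1 ∨ σ = -1) {d₁ d₂ : ℕ} (hd₁ : d₁ ≠ 0) (hd₁e : Even d₁)
    (hd₂ : Odd d₂) :
    Summable (fun k : ℕ => (k : ℝ) ^ δ * ‖paritySingTerm α σ d₁ d₂ k‖) ∧
      ∑' k : ℕ, (k : ℝ) ^ δ * ‖paritySingTerm α σ d₁ d₂ k‖ ≤
        3 * ((d₁ * d₂ : ℕ) : ℝ) ^ α * Real.exp (2420 * (1 - α) / (3 * α - 13 / 5 - δ)) := by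
  have hα0 : 0 ≤ α := by linarith
  have hδ1 : δ ≤ 1 := by linarith
  have hσd := odd_sigma_mul hσ hd₂
  obtain ⟨hg, hgle⟩ := summable_rpow_mul_norm_parityUnitTerm hα hα1 hδ hσ hd₁ hd₂.pos.ne'
  set f : ℕ → ℝ := fun k => (k : ℝ) ^ δ * ‖paritySingTerm α σ d₁ d₂ k‖ with hf
  set g : ℕ → ℝ := fun k => (k : ℝ) ^ δ * ‖parityUnitTerm α σ d₁ d₂ k‖ with hgdef
  have hg0 : ∀ k, 0 ≤ g k := fun k => mul_nonneg (Real.rpow_nonneg (Nat.cast_nonneg k) _) (norm_nonneg _)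
  have hf0 : ∀ k, 0 ≤ f k := fun k => mul_nonneg (Real.rpow_nonneg (Nat.cast_nonneg k) _) (norm_nonneg _)
  have hinj : Function.Injective (fun k : ℕ => 2 * k + 1) := fun a b h => by simp only at h; omega
  have he : ∀ k, f (2 * k) ≤ 2 * g k := by
    intro k
    have h1 : (((2 * k : ℕ)) : ℝ) ^ δ = (2 : ℝ) ^ δ * (k : ℝ) ^ δ := by
      push_cast; exact Real.mul_rpow (by norm_num) (Nat.cast_nonneg k)
    have h2 : (2 : ℝ) ^ δ ≤ 2 := by
      calc (2 : ℝ) ^ δ ≤ (2 : ℝ) ^ (1 : ℝ) := Real.rpow_le_rpow_of_exponent_le (by norm_num) hδ1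
        _ = 2 := Real.rpow_one 2
    have hk0 : 0 ≤ (k : ℝ) ^ δ := Real.rpow_nonneg (Nat.cast_nonneg k) _
    simp only [hf, hgdef]
    rw [h1]
    calc (2 : ℝ) ^ δ * (k : ℝ) ^ δ * ‖paritySingTerm α σ d₁ d₂ (2 * k)‖
        ≤ 2 * (k : ℝ) ^ δ * ‖parityUnitTerm α σ d₁ d₂ k‖ :=
          mul_le_mul (mul_le_mul_of_nonneg_right h2 hk0) (norm_paritySingTerm_two_mul_le hα0 hα1 hσd hd₁e k)
            (norm_nonneg _) (by positivity)
      _ = 2 * ((k : ℝ) ^ δ * ‖parityUnitTerm α σ d₁ d₂ k‖) := by ring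
  have ho : ∀ k, f (2 * k + 1) ≤ g (2 * k + 1) := fun k =>
    mul_le_mul_of_nonneg_left (norm_paritySingTerm_odd_le hα0 σ d₁ d₂ k) (Real.rpow_nonneg (Nat.cast_nonneg _) _)
  have hg2 : Summable (fun k => 2 * g k) := hg.mul_left 2
  have hgo : Summable (fun k => g (2 * k + 1)) := hg.comp_injective hinj
  have hge : Summable (fun k => g (2 * k)) := hg.comp_injective (mul_right_injective₀ two_ne_zero)
  have hse : Summable (fun k => f (2 * k)) := hg2.of_nonneg_of_le (fun k => hf0 _) he
  have hso : Summable (fun k => f (2 * k + 1)) := hgo.of_nonneg_of_le (fun k => hf0 _) ho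
  refine ⟨Summable.even_add_odd hse hso, ?_⟩
  rw [← tsum_even_add_odd hse hso]
  have h1 : ∑' k, f (2 * k) ≤ 2 * ∑' k, g k := by
    rw [← hg.tsum_mul_left 2]; exact Summable.tsum_le_tsum he hse hg2
  have h2 : ∑' k, f (2 * k + 1) ≤ ∑' k, g k := by
    calc ∑' k, f (2 * k + 1) ≤ ∑' k, g (2 * k + 1) := Summable.tsum_le_tsum ho hso hgo
      _ ≤ ∑' k, g k := by
        rw [← tsum_even_add_odd hge hgo]
        have h0 : 0 ≤ ∑' k, g (2 * k) := tsum_nonneg fun k => hg0 (2 * k)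
        linarith
  linarith

/-- **(S1) Absolute convergence of the singular series**: `Σ_k ‖paritySingTerm k‖ < ∞`, with
`Σ_k ‖paritySingTerm k‖ ≤ 3 (d₁d₂)^α exp(2420(1−α)/(3α − 13/5))`. [cite: MontgomeryVaughanActa1975, §6] -/
theorem summable_norm_paritySingTerm {α : ℝ} (hα : 13 / 15 < α) (hα1 : α ≤ 1) {σ : ℤ} (hσ : σ = 1 ∨ σ = -1)
    {d₁ d₂ : ℕ} (hd₁ : d₁ ≠ 0) (hd₁e : Even d₁) (hd₂ : Odd d₂) :
    Summable (fun k : ℕ => ‖paritySingTerm α σ d₁ d₂ k‖) ∧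
      ∑' k : ℕ, ‖paritySingTerm α σ d₁ d₂ k‖ ≤
        3 * ((d₁ * d₂ : ℕ) : ℝ) ^ α * Real.exp (2420 * (1 - α) / (3 * α - 13 / 5)) := by
  obtain ⟨h1, h2⟩ := summable_rpow_mul_norm_paritySingTerm hα hα1 (by linarith) hσ hd₁ hd₁e hd₂ (δ := 0)
  simp only [Real.rpow_zero, one_mul, sub_zero] at h1 h2
  exact ⟨h1, h2⟩

/-- **(S1) Explicit tail**: for `0 < δ < 3α − 13/5` and `R ≥ 1`,
`Σ_{k ≥ R} ‖paritySingTerm k‖ ≤ 3 (d₁d₂)^α exp(2420(1−α)/(3α − 13/5 − δ)) · R^{−δ}`. [cite: MontgomeryVaughanActa1975, §6] -/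
theorem tsum_norm_paritySingTerm_add_le {α : ℝ} (hα : 13 / 15 < α) (hα1 : α ≤ 1) {δ : ℝ} (hδ0 : 0 < δ)
    (hδ : δ < 3 * α - 13 / 5) {σ : ℤ} (hσ : σ = 1 ∨ σ = -1) {d₁ d₂ : ℕ} (hd₁ : d₁ ≠ 0) (hd₁e : Even d₁)
    (hd₂ : Odd d₂) {R : ℕ} (hR : R ≠ 0) :
    ∑' k : ℕ, ‖paritySingTerm α σ d₁ d₂ (k + R)‖ ≤
      3 * ((d₁ * d₂ : ℕ) : ℝ) ^ α * Real.exp (2420 * (1 - α) / (3 * α - 13 / 5 - δ)) * (R : ℝ) ^ (-δ) := by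
  obtain ⟨hf, hfle⟩ := summable_rpow_mul_norm_paritySingTerm hα hα1 hδ hσ hd₁ hd₁e hd₂
  set f : ℕ → ℝ := fun k => (k : ℝ) ^ δ * ‖paritySingTerm α σ d₁ d₂ k‖ with hfdef
  have hf0 : ∀ k, 0 ≤ f k := fun k => mul_nonneg (Real.rpow_nonneg (Nat.cast_nonneg k) _) (norm_nonneg _)
  have hR0 : (0 : ℝ) < R := by exact_mod_cast Nat.pos_of_ne_zero hR
  have hRδ : 0 ≤ (R : ℝ) ^ (-δ) := Real.rpow_nonneg hR0.le _
  have hpt : ∀ k, ‖paritySingTerm α σ d₁ d₂ (k + R)‖ ≤ (R : ℝ) ^ (-δ) * f (k + R) := by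
    intro k
    have hkR : (0 : ℝ) < ((k + R : ℕ) : ℝ) := by exact_mod_cast Nat.add_pos_right k (Nat.pos_of_ne_zero hR)
    have e : ‖paritySingTerm α σ d₁ d₂ (k + R)‖ = ((k + R : ℕ) : ℝ) ^ (-δ) * f (k + R) := by
      simp only [hfdef]
      rw [← mul_assoc, ← Real.rpow_add hkR, neg_add_cancel, Real.rpow_zero, one_mul]
    rw [e]
    exact mul_le_mul_of_nonneg_right
      (Real.rpow_le_rpow_of_nonpos hR0 (by exact_mod_cast Nat.le_add_left R k) (by linarith)) (hf0 _)
  have hfR : Summable (fun k => f (k + R)) := (summable_nat_add_iff R).mpr hf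
  have htail : ∑' k, f (k + R) ≤ ∑' k, f k := by
    rw [← hf.sum_add_tsum_nat_add R]
    linarith [Finset.sum_nonneg (fun k (_ : k ∈ Finset.range R) => hf0 k)]
  calc ∑' k, ‖paritySingTerm α σ d₁ d₂ (k + R)‖ ≤ ∑' k, (R : ℝ) ^ (-δ) * f (k + R) :=
        Summable.tsum_le_tsum hpt ((hfR.mul_left _).of_nonneg_of_le (fun _ => norm_nonneg _) hpt) (hfR.mul_left _)
    _ = (R : ℝ) ^ (-δ) * ∑' k, f (k + R) := hfR.tsum_mul_left _
    _ ≤ (R : ℝ) ^ (-δ) * (3 * ((d₁ * d₂ : ℕ) : ℝ) ^ α * Real.exp (2420 * (1 - α) / (3 * α - 13 / 5 - δ))) :=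
        mul_le_mul_of_nonneg_left (htail.trans hfle) hRδ
    _ = _ := by ring

/-! ### The singular series as `2(1 − 2^{−α})³ ×` the odd part; positivity and bounds (S4) -/

/-- Summability of the unit terms (complex) and of the real unit terms. [folklore] -/
theorem summable_parityUnitTerm {α : ℝ} (hα : 13 / 15 < α) (hα1 : α ≤ 1) {σ : ℤ} (hσ : σ = 1 ∨ σ = -1)
    {d₁ d₂ : ℕ} (hd₁ : d₁ ≠ 0) (hd₂ : d₂ ≠ 0) :
    Summable (parityUnitTerm α σ d₁ d₂) ∧ Summable (parityUnitTermR α d₁ d₂) ∧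
      ∑' k, parityUnitTermR α d₁ d₂ k ≤ ((d₁ * d₂ : ℕ) : ℝ) ^ α * Real.exp (2420 * (1 - α) / (3 * α - 13 / 5)) := by
  have hα0 : 0 ≤ α := by linarith
  obtain ⟨h1, h2⟩ := summable_rpow_mul_norm_parityUnitTerm hα hα1 (by linarith) hσ hd₁ hd₂ (δ := 0)
  simp only [Real.rpow_zero, one_mul, sub_zero, norm_parityUnitTerm hα0 hα1 hσ] at h1 h2
  refine ⟨Summable.of_norm ?_, h1, h2⟩
  simpa only [norm_parityUnitTerm hα0 hα1 hσ] using h1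

/-- **The singular series factorises**: for `13/15 < α ≤ 1`, `σ = ±1`, `d₁ ≥ 1` even and `d₂` odd,
`𝔖 = (paritySingTerm 1 + paritySingTerm 2) · Σ_{k odd} T(k) = 2(1 − 2^{−α})³ · Σ_m T(2m+1)`
(absolute convergence, the even/odd split twice, `paritySingTerm (4m) = 0`, multiplicativity). [cite: MontgomeryVaughanActa1975, §6] -/
theorem paritySingSeries_eq {α : ℝ} (hα : 13 / 15 < α) (hα1 : α ≤ 1) {σ : ℤ} (hσ : σ = 1 ∨ σ = -1) {d₁ d₂ : ℕ}
    (hd₁ : d₁ ≠ 0) (hd₁e : Even d₁) (hd₂ : Odd d₂) :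
    paritySingSeries α σ d₁ d₂ =
      ((2 * (1 - (2 : ℝ) ^ (-α)) ^ 3 * ∑' m : ℕ, parityUnitTermR α d₁ d₂ (2 * m + 1) : ℝ) : ℂ) := by
  have hσd := odd_sigma_mul hσ hd₂
  obtain ⟨hT, -, -⟩ := summable_parityUnitTerm hα hα1 hσ hd₁ hd₂.pos.ne'
  have hterm : Summable (paritySingTerm α σ d₁ d₂) := (summable_norm_paritySingTerm hα hα1 hσ hd₁ hd₁e hd₂).1.of_norm
  have hinj : Function.Injective (fun k : ℕ => 2 * k + 1) := fun a b h => by simp only at h; omega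
  have hTo : Summable (fun m => parityUnitTerm α σ d₁ d₂ (2 * m + 1)) := hT.comp_injective hinj
  -- odd indices
  have e1 : ∀ m, paritySingTerm α σ d₁ d₂ (2 * m + 1) =
      paritySingTerm α σ d₁ d₂ 1 * parityUnitTerm α σ d₁ d₂ (2 * m + 1) := fun m => by
    have := paritySingTerm_mul_of_coprime α σ d₁ d₂ (Nat.coprime_one_left (2 * m + 1)) (odd_two_mul_add_one m)
    rwa [one_mul] at this
  -- even indices: `2(2m)` vanishes, `2(2m+1) = 2 · odd`
  have e2 : ∀ m, paritySingTerm α σ d₁ d₂ (2 * (2 * m)) = 0 := fun m =>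
    paritySingTerm_eq_zero_of_four_dvd α hσd d₁ ⟨m, by ring⟩
  have e3 : ∀ m, paritySingTerm α σ d₁ d₂ (2 * (2 * m + 1)) =
      paritySingTerm α σ d₁ d₂ 2 * parityUnitTerm α σ d₁ d₂ (2 * m + 1) := fun m =>
    paritySingTerm_mul_of_coprime α σ d₁ d₂
      (Nat.prime_two.coprime_iff_not_dvd.mpr (odd_two_mul_add_one m).not_two_dvd_nat) (odd_two_mul_add_one m)
  have hse : Summable (fun m => paritySingTerm α σ d₁ d₂ (2 * m)) :=
    hterm.comp_injective (mul_right_injective₀ two_ne_zero)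
  have hso : Summable (fun m => paritySingTerm α σ d₁ d₂ (2 * m + 1)) := hterm.comp_injective hinj
  have hsee : Summable (fun m => paritySingTerm α σ d₁ d₂ (2 * (2 * m))) := by
    simp only [e2]; exact summable_zero
  have hseo : Summable (fun m => paritySingTerm α σ d₁ d₂ (2 * (2 * m + 1))) := by
    simp only [e3]; exact hTo.mul_left _
  have hE : ∑' m, paritySingTerm α σ d₁ d₂ (2 * m) =
      paritySingTerm α σ d₁ d₂ 2 * ∑' m, parityUnitTerm α σ d₁ d₂ (2 * m + 1) := by
    have h := tsum_even_add_odd (f := fun m => paritySingTerm α σ d₁ d₂ (2 * m)) hsee hseo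
    simp only [e2, e3, tsum_zero, zero_add] at h
    rw [← h]
    exact hTo.tsum_mul_left _
  have hO : ∑' m, paritySingTerm α σ d₁ d₂ (2 * m + 1) =
      paritySingTerm α σ d₁ d₂ 1 * ∑' m, parityUnitTerm α σ d₁ d₂ (2 * m + 1) := by
    simp only [e1]; exact hTo.tsum_mul_left _
  unfold paritySingSeries
  rw [← tsum_even_add_odd hse hso, hE, hO, ← add_mul, paritySingTerm_one, paritySingTerm_two α hσd hd₁e]
  simp only [parityUnitTerm_eq_ofReal α hσ]
  rw [← Complex.ofReal_tsum]
  push_cast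
  ring

/-- Equivalently `𝔖 = parityLocalTwo · Σ_m parityUnitTerm (2m+1)` (the `2`-adic factor times the odd part).
[cite: MontgomeryVaughanActa1975, §6] -/
theorem paritySingSeries_eq_parityLocalTwo_mul {α : ℝ} (hα : 13 / 15 < α) (hα1 : α ≤ 1) {σ : ℤ}
    (hσ : σ = 1 ∨ σ = -1) {d₁ d₂ : ℕ} (hd₁ : d₁ ≠ 0) (hd₁e : Even d₁) (hd₂ : Odd d₂) :
    paritySingSeries α σ d₁ d₂ = parityLocalTwo α σ d₁ d₂ * ∑' m : ℕ, parityUnitTerm α σ d₁ d₂ (2 * m + 1) := by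
  rw [paritySingSeries_eq hα hα1 hσ hd₁ hd₁e hd₂, parityLocalTwo_eq α hσ hd₁e hd₂]
  simp only [parityUnitTerm_eq_ofReal α hσ]
  rw [← Complex.ofReal_tsum]
  push_cast
  ring

/-- The odd part is at least its first term: `1 = T(1) ≤ Σ_m T(2m+1)`. [folklore] -/
theorem one_le_tsum_parityUnitTermR_odd {α : ℝ} (hα : 13 / 15 < α) (hα1 : α ≤ 1) {d₁ d₂ : ℕ} (hd₁ : d₁ ≠ 0)
    (hd₂ : d₂ ≠ 0) : 1 ≤ ∑' m : ℕ, parityUnitTermR α d₁ d₂ (2 * m + 1) := by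
  have hα0 : 0 ≤ α := by linarith
  obtain ⟨-, hs, -⟩ := summable_parityUnitTerm hα hα1 (Or.inl rfl) hd₁ hd₂
  have hinj : Function.Injective (fun k : ℕ => 2 * k + 1) := fun a b h => by simp only at h; omega
  have hso : Summable (fun m => parityUnitTermR α d₁ d₂ (2 * m + 1)) := hs.comp_injective hinj
  calc (1 : ℝ) = ∑ m ∈ ({0} : Finset ℕ), parityUnitTermR α d₁ d₂ (2 * m + 1) := by simp [parityUnitTermR_one]
    _ ≤ ∑' m : ℕ, parityUnitTermR α d₁ d₂ (2 * m + 1) :=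
        hso.sum_le_tsum {0} fun m _ => parityUnitTermR_nonneg hα0 hα1 _ _ _

/-- **(S4) The singular series is real**: `𝔖.im = 0`. [cite: MontgomeryVaughanActa1975, §6] -/
theorem paritySingSeries_im {α : ℝ} (hα : 13 / 15 < α) (hα1 : α ≤ 1) {σ : ℤ} (hσ : σ = 1 ∨ σ = -1) {d₁ d₂ : ℕ}
    (hd₁ : d₁ ≠ 0) (hd₁e : Even d₁) (hd₂ : Odd d₂) : (paritySingSeries α σ d₁ d₂).im = 0 := by
  rw [paritySingSeries_eq hα hα1 hσ hd₁ hd₁e hd₂, Complex.ofReal_im]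

/-- **(S4) Positivity / lower bound**: `𝔖.re ≥ 2(1 − 2^{−α})³` (`> 0`): the odd Euler part is `≥ T(1) = 1` since every
`T(k) ≥ 0`. [cite: MontgomeryVaughanActa1975, §6] -/
theorem le_paritySingSeries_re {α : ℝ} (hα : 13 / 15 < α) (hα1 : α ≤ 1) {σ : ℤ} (hσ : σ = 1 ∨ σ = -1) {d₁ d₂ : ℕ}
    (hd₁ : d₁ ≠ 0) (hd₁e : Even d₁) (hd₂ : Odd d₂) :
    2 * (1 - (2 : ℝ) ^ (-α)) ^ 3 ≤ (paritySingSeries α σ d₁ d₂).re := by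
  rw [paritySingSeries_eq hα hα1 hσ hd₁ hd₁e hd₂, Complex.ofReal_re]
  have h1 := one_le_tsum_parityUnitTermR_odd hα hα1 hd₁ hd₂.pos.ne' (α := α)
  have h0 := two_mul_one_sub_two_rpow_pos (by linarith : (0 : ℝ) < α)
  nlinarith

/-- **(S4) Upper bound**: `‖𝔖‖ ≤ Σ ‖paritySingTerm k‖ ≤ 3 (d₁d₂)^α exp(2420(1−α)/(3α − 13/5))`.
[cite: MontgomeryVaughanActa1975, §6] -/
theorem norm_paritySingSeries_le {α : ℝ} (hα : 13 / 15 < α) (hα1 : α ≤ 1) {σ : ℤ} (hσ : σ = 1 ∨ σ = -1)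
    {d₁ d₂ : ℕ} (hd₁ : d₁ ≠ 0) (hd₁e : Even d₁) (hd₂ : Odd d₂) :
    ‖paritySingSeries α σ d₁ d₂‖ ≤ 3 * ((d₁ * d₂ : ℕ) : ℝ) ^ α * Real.exp (2420 * (1 - α) / (3 * α - 13 / 5)) := by
  obtain ⟨h1, h2⟩ := summable_norm_paritySingTerm hα hα1 hσ hd₁ hd₁e hd₂
  exact (norm_tsum_le_tsum_norm h1).trans h2

/-! ### The Euler product of the odd part (S2) -/

/-- **Euler product.** For `13/15 < α ≤ 1`, `σ = ±1`, `d₁, d₂ ≥ 1`: the multiplicative function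
`k ↦ [k odd] · T(k)` has the absolutely convergent Euler product
`∏_p E_p = Σ_m T(2m+1)` with `E_2 = 1` and `E_p = parityLocalOdd p` for odd `p`
(Mathlib's `EulerProduct.eulerProduct_hasProd`). [cite: MontgomeryVaughanActa1975, §6] -/
theorem hasProd_parityLocalOdd {α : ℝ} (hα : 13 / 15 < α) (hα1 : α ≤ 1) {σ : ℤ} (hσ : σ = 1 ∨ σ = -1) {d₁ d₂ : ℕ}
    (hd₁ : d₁ ≠ 0) (hd₂ : d₂ ≠ 0) :
    HasProd (fun p : Nat.Primes => if (p : ℕ) = 2 then (1 : ℂ) else parityLocalOdd α σ d₁ d₂ p)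
      (∑' m : ℕ, parityUnitTerm α σ d₁ d₂ (2 * m + 1)) := by
  have hα0 : 0 ≤ α := by linarith
  obtain ⟨hT, -, -⟩ := summable_parityUnitTerm hα hα1 hσ hd₁ hd₂
  have hinj : Function.Injective (fun k : ℕ => 2 * k + 1) := fun a b h => by simp only at h; omega
  have hTo : Summable (fun m => parityUnitTerm α σ d₁ d₂ (2 * m + 1)) := hT.comp_injective hinj
  set f : ℕ → ℂ := fun n => if Odd n then parityUnitTerm α σ d₁ d₂ n else 0 with hf
  have hT1 : parityUnitTerm α σ d₁ d₂ 1 = 1 := by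
    rw [parityUnitTerm_eq_ofReal α hσ, parityUnitTermR_one, Complex.ofReal_one]
  have hf1 : f 1 = 1 := by simp [hf, hT1]
  have hf0 : f 0 = 0 := by simp [hf]
  have hmul : ∀ {m n : ℕ}, m.Coprime n → f (m * n) = f m * f n := by
    intro m n hmn
    simp only [hf, Nat.odd_mul]
    by_cases hm : Odd m
    · by_cases hn : Odd n
      · rw [if_pos ⟨hm, hn⟩, if_pos hm, if_pos hn, parityUnitTerm_mul_of_coprime α σ d₁ d₂ hmn]
      · rw [if_neg (fun h => hn h.2), if_neg hn, mul_zero]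
    · rw [if_neg (fun h => hm h.1), if_neg hm, zero_mul]
  have hle : ∀ n, ‖f n‖ ≤ ‖parityUnitTerm α σ d₁ d₂ n‖ := fun n => by
    simp only [hf]; split_ifs <;> simp
  have hsum : Summable (fun n => ‖f n‖) := hT.norm.of_nonneg_of_le (fun _ => norm_nonneg _) hle
  have hE := EulerProduct.eulerProduct_hasProd hf1 hmul hsum hf0
  have hS : ∑' n, f n = ∑' m, parityUnitTerm α σ d₁ d₂ (2 * m + 1) := by
    have hfe : ∀ m, f (2 * m) = 0 := fun m => by simp [hf]
    have hfo : ∀ m, f (2 * m + 1) = parityUnitTerm α σ d₁ d₂ (2 * m + 1) := fun m => by simp [hf]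
    rw [← tsum_even_add_odd (f := f) (by simp only [hfe]; exact summable_zero) (by simp only [hfo]; exact hTo)]
    simp only [hfe, hfo, tsum_zero, zero_add]
  have hF : ∀ p : Nat.Primes, ∑' e, f (p ^ e) = if (p : ℕ) = 2 then 1 else parityLocalOdd α σ d₁ d₂ p := by
    intro p
    split_ifs with h2
    · rw [h2]
      have h2e : ∀ e : ℕ, f (2 ^ e) = if e = 0 then 1 else 0 := by
        intro e
        rcases eq_or_ne e 0 with rfl | he
        · simp [hf1]
        · have : ¬ Odd (2 ^ e) := by
            rw [Nat.odd_pow_iff he]; decide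
          simp [hf, this, he]
      simp only [h2e]
      exact tsum_ite_eq 0 1
    · have hodd : Odd (p : ℕ) := p.prop.eq_two_or_odd'.resolve_left h2
      have h3 : ∀ e : ℕ, f (p ^ e) = parityUnitTerm α σ d₁ d₂ (p ^ e) := fun e => by simp [hf, hodd.pow]
      simp only [h3]
      rfl
  rw [← hS]
  convert hE using 1
  funext p
  exact (hF p).symm

/-- **The odd local factors are real, `≥ 1`**: for an odd prime `p`, `parityLocalOdd p = Σ_e T(p^e)` with
`T(p^e) ≥ 0` and `T(1) = 1`. [cite: MontgomeryVaughanActa1975, §6] -/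
theorem parityLocalOdd_eq_ofReal {α : ℝ} (hα : 13 / 15 < α) (hα1 : α ≤ 1) {σ : ℤ} (hσ : σ = 1 ∨ σ = -1)
    {d₁ d₂ : ℕ} (hd₁ : d₁ ≠ 0) (hd₂ : d₂ ≠ 0) {p : ℕ} (hp : p.Prime) :
    parityLocalOdd α σ d₁ d₂ p = ((∑' e : ℕ, parityUnitTermR α d₁ d₂ (p ^ e) : ℝ) : ℂ) ∧
      1 ≤ ∑' e : ℕ, parityUnitTermR α d₁ d₂ (p ^ e) := by
  have hα0 : 0 ≤ α := by linarith
  obtain ⟨-, hs, -⟩ := summable_parityUnitTerm hα hα1 hσ hd₁ hd₂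
  have hsp : Summable (fun e => parityUnitTermR α d₁ d₂ (p ^ e)) :=
    hs.comp_injective (Nat.pow_right_injective hp.two_le)
  refine ⟨?_, ?_⟩
  · change ∑' e : ℕ, parityUnitTerm α σ d₁ d₂ (p ^ e) = _
    simp only [parityUnitTerm_eq_ofReal α hσ]
    exact (Complex.ofReal_tsum _).symm
  · calc (1 : ℝ) = ∑ e ∈ ({0} : Finset ℕ), parityUnitTermR α d₁ d₂ (p ^ e) := by simp [parityUnitTermR_one]
      _ ≤ _ := hsp.sum_le_tsum {0} fun e _ => parityUnitTermR_nonneg hα0 hα1 _ _ _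

/-- **The odd local factors at primes `p ∤ d₁d₂` are `1 + O((1−α) log³p · p^{1−3α})`**:
`Σ_e T(p^e) ≤ 1 + 2 c_p p^{−(3α−1)}` (`T(p^e) ≤ M(p^e) = c_p p^{−e(3α−1)}` for `e ≥ 1`, geometric series with ratio
`≤ 1/2`). [cite: MontgomeryVaughanActa1975, §6] -/
theorem tsum_parityUnitTermR_prime_pow_le {α : ℝ} (hα : 13 / 15 < α) (hα1 : α ≤ 1) {d₁ d₂ : ℕ} (hd₁ : d₁ ≠ 0)
    (hd₂ : d₂ ≠ 0) {p : ℕ} (hp : p.Prime) (hp₁ : ¬ p ∣ d₁) (hp₂ : ¬ p ∣ d₂) :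
    ∑' e : ℕ, parityUnitTermR α d₁ d₂ (p ^ e) ≤ 1 + 2 * majorConst α p * (p : ℝ) ^ (-(3 * α - 1)) := by
  have hα0 : 0 ≤ α := by linarith
  obtain ⟨-, hs, -⟩ := summable_parityUnitTerm hα hα1 (Or.inl rfl) hd₁ hd₂
  have hsp : Summable (fun e => parityUnitTermR α d₁ d₂ (p ^ e)) :=
    hs.comp_injective (Nat.pow_right_injective hp.two_le)
  have hp2 : (2 : ℝ) ≤ p := by exact_mod_cast hp.two_le
  set r : ℝ := (p : ℝ) ^ (-(3 * α - 1)) with hr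
  have hr0 : 0 ≤ r := Real.rpow_nonneg (by linarith) _
  have hr2 : r ≤ 1 / 2 := by
    calc r ≤ (p : ℝ) ^ (-1 : ℝ) := Real.rpow_le_rpow_of_exponent_le (by linarith) (by linarith)
      _ = 1 / p := by rw [Real.rpow_neg_one]; ring
      _ ≤ 1 / 2 := by gcongr
  have hr1 : r < 1 := by linarith
  have hc := majorConst_nonneg hα1 p
  have hgcd : ∀ {d : ℕ}, ¬ p ∣ d → ∀ e : ℕ, Nat.gcd d (p ^ (e + 1)) = 1 := fun hd e =>
    (Nat.Coprime.pow_right (e + 1) ((Nat.Prime.coprime_iff_not_dvd hp).mpr hd).symm).gcd_eq_one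
  have hle : ∀ e : ℕ, parityUnitTermR α d₁ d₂ (p ^ (e + 1)) ≤ majorConst α p * r * r ^ e := by
    intro e
    refine (parityUnitTermR_prime_pow_le hα0 hα1 d₁ d₂ hp (Nat.succ_pos e)).trans (le_of_eq ?_)
    rw [unitMajorant, hgcd hp₁ e, hgcd hp₂ e, mul_one, Nat.cast_one, Real.one_rpow, one_mul,
      Nat.primeFactors_prime_pow (Nat.succ_ne_zero e) hp, Finset.prod_singleton, hr, ← Real.rpow_natCast,
      ← Real.rpow_mul (by linarith), mul_assoc, ← Real.rpow_add (by linarith), Nat.cast_pow,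
      ← Real.rpow_natCast (p : ℝ) (e + 1), ← Real.rpow_mul (by linarith)]
    push_cast
    ring_nf
  rw [hsp.tsum_eq_zero_add, pow_zero, parityUnitTermR_one]
  have hgeom : HasSum (fun e : ℕ => majorConst α p * r * r ^ e) (majorConst α p * r * (1 - r)⁻¹) :=
    (hasSum_geometric_of_lt_one hr0 hr1).mul_left _
  have htail : ∑' e : ℕ, parityUnitTermR α d₁ d₂ (p ^ (e + 1)) ≤ majorConst α p * r * (1 - r)⁻¹ :=
    hasSum_le hle ((summable_nat_add_iff 1).mpr hsp).hasSum hgeom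
  have hinv : (1 - r)⁻¹ ≤ 2 := by rw [inv_le_comm₀ (by linarith) (by norm_num)]; linarith
  have : majorConst α p * r * (1 - r)⁻¹ ≤ majorConst α p * r * 2 :=
    mul_le_mul_of_nonneg_left hinv (mul_nonneg hc hr0)
  linarith

end SmoothArcs

end Literature.NumberTheory.Sieve

end
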